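import Literature.NumberTheory.Automorphic.Liu2021.AppendixC.OmegaHomTransfer
import Literature.NumberTheory.Automorphic.AutomorphicGLnFlathProofs
import HarnessLib

/-!
# [Liu 2021, proof of Thm. 4.15 / Thm. D.6 (1)] the block `{f w | f ∈ Hom_𝔾(ι∘ρ, H¹_ét)}` depends only on the ISOMORPHISM CLASS
# of the oscillator module; a non-zero restricted tensor product has non-zero local factors

Topic `NumberTheory/Automorphic/Liu2021/AppendixC`; namespaces `Literature.NumberTheory.Automorphic.Liu2021.AppendixC.Sec42Data.EtaleHeckeDatum`
(home of ★ `omegaHom`, `comp_mem_omegaHom`) and `Literature.NumberTheory.Automorphic` (home of `IsRestrictedTensorProduct`).  THEOREMS ONLY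
(no definition, no named fact, no instance, no `sorry`).  Orientation-free; nothing of [Liu2021] is asserted.

For an étale Hecke datum `X` of a §4.2 datum `C`, `ι : ℂ ≃ ℚ̄_ℓ` and a `ℂ[𝔾]`-module `(W, ρ)`, the d6 line reads every socket on the BLOCK of values
`{f w | f ∈ X.omegaHom ι ρ, w ∈ W} ⊆ ℚ̄_ℓ ⊗ H¹_ét` (★ `ThmD6CompositionGeneric`, where the set is written inline).  [Liu2021] identifies `π^∞`
only up to isomorphism («`π^∞ ≅ ω(μ, ε, χ)`», Thm. D.6 (1) l. 5436; Lem. D.1 (4) gives TWO labels at `n = 2`), so every text over the block must be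
invariant under a `𝔾`-equivariant isomorphism of the module:

* `blockSet_subset_of_surjective` — along an equivariant SURJECTION `j : W′ ↠ W` the block of `ρ` is contained in the block of `ρ′`
  (★ `comp_mem_omegaHom`: `f ↦ f ∘ j`);
* **`blockSet_eq_of_equiv`**, `span_blockSet_eq_of_equiv` — along an equivariant linear ISOMORPHISM `e : W ≃ W′` the two blocks (and their
  `ℚ̄_ℓ`-spans) coincide;
* **`IsRestrictedTensorProduct.nontrivial_factor`** — if `(W, j) = ⊗'_i (V i, x₀ i)` is a restricted tensor product and `W ≠ 0`, then every
  `V i ≠ 0` (a zero factor kills every `j x` by restricted multilinearity, while the `j x` span `W`): the input «`ω(μ,ε,χ) ≠ 0 ⇒ ω(μ_v,ε_v,χ_v) ≠ 0`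
  at every `v`» of [Liu2021, Lem. D.1 (4)] for an adèlic `ω = ⊗′_v ω_v` (Def. 4.11).

Consumer: cell hodgecm-mathlib, d6 line census `CENSUS-S1b-CaseB-relabel` rows 8–9 (S1b Case-B relabel).  HC_CM is proved only modulo the
7 printed citations until rung 0 closes; this file proves no cell binder.

## References
* [Liu2021] Y. Liu, *Fourier–Jacobi cycles and arithmetic relative trace formula*, Camb. J. Math. 9 (2021) = arXiv:2102.11518: §4.2 (l. 2162–2165),
  Def. 4.11 (l. 2092–2096), Thm. D.6 (1) (l. 5436), Lem. D.1 (4) (l. 5235).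
* [Flath1979] D. Flath, *Decomposition of representations into tensor products*, Corvallis 1979, §2.
-/

set_option autoImplicit false

noncomputable section

open NumberField
open scoped TensorProduct RestrictedProduct

namespace Literature.NumberTheory.Automorphic.Liu2021.AppendixC

variable {F E : Type} [Field F] [NumberField F] [IsTotallyReal F] [Field E] [NumberField E] [Algebra F E]
  [IsTotallyComplex E] [Algebra.IsQuadraticExtension F E]
variable {P5 : PropC5Data F E} {isotropicAt : ℕ → Prop}

namespace Sec42Data.EtaleHeckeDatum

variable {C : Sec42Data P5 isotropicAt} {ℓ : ℕ} [Fact ℓ.Prime] (X : C.EtaleHeckeDatum ℓ) (ι : ℂ ≃+* AlgebraicClosure ℚ_[ℓ])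

/-- **The block shrinks along an equivariant surjection**: if `j : W′ → W` is `ℂ`-linear, `𝔾`-equivariant and surjective, every value `f w`
(`f ∈ Hom_𝔾(ι∘ρ, H¹)`, `w ∈ W`) is a value `(f ∘ j) w′` with `f ∘ j ∈ Hom_𝔾(ι∘ρ′, H¹)`.
[cite: Liu2021, §4.2 (FJcycle.tex l. 2162–2165); Thm. D.6 (1) (l. 5436)] -/
theorem blockSet_subset_of_surjective {W W' : Type} [AddCommGroup W] [Module ℂ W] [AddCommGroup W'] [Module ℂ W']
    (ρW : Representation ℂ C.G W) (ρW' : Representation ℂ C.G W') (j : W' →ₗ[ℂ] W)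
    (hj : ∀ (g : C.G) (w : W'), j (ρW' g w) = ρW g (j w)) (hsurj : Function.Surjective j) :
    {y | ∃ f ∈ X.omegaHom ι ρW, ∃ w : W, f w = y} ⊆ {y | ∃ f' ∈ X.omegaHom ι ρW', ∃ w' : W', f' w' = y} := by
  rintro y ⟨f, hf, w, rfl⟩
  obtain ⟨w', rfl⟩ := hsurj w
  exact ⟨f.comp j, X.comp_mem_omegaHom ι ρW ρW' j hj hf, w', rfl⟩

/-- **The block is an invariant of the isomorphism class of the module**: along a `𝔾`-equivariant linear isomorphism `e : W ≃ W′` the blocks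
of values of `Hom_𝔾(ι∘ρ, H¹)` and `Hom_𝔾(ι∘ρ′, H¹)` coincide. [cite: Liu2021, Thm. D.6 (1) (FJcycle.tex l. 5436); Lem. D.1 (4) (l. 5235)] -/
theorem blockSet_eq_of_equiv {W W' : Type} [AddCommGroup W] [Module ℂ W] [AddCommGroup W'] [Module ℂ W']
    (ρW : Representation ℂ C.G W) (ρW' : Representation ℂ C.G W') (e : W ≃ₗ[ℂ] W')
    (he : ∀ (g : C.G) (w : W), e (ρW g w) = ρW' g (e w)) :
    {y | ∃ f ∈ X.omegaHom ι ρW, ∃ w : W, f w = y} = {y | ∃ f' ∈ X.omegaHom ι ρW', ∃ w' : W', f' w' = y} := by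
  have he' : ∀ (g : C.G) (w' : W'), e.symm (ρW' g w') = ρW g (e.symm w') := fun g w' => by
    apply e.injective
    rw [e.apply_symm_apply, he, e.apply_symm_apply]
  refine Set.Subset.antisymm ?_ ?_
  · exact X.blockSet_subset_of_surjective ι ρW ρW' (e.symm : W' →ₗ[ℂ] W) he' e.symm.surjective
  · exact X.blockSet_subset_of_surjective ι ρW' ρW (e : W →ₗ[ℂ] W') he e.surjective

/-- … hence the `ℚ̄_ℓ`-spans of the two blocks coincide. [cite: Liu2021, Thm. D.6 (1) (FJcycle.tex l. 5436); Lem. D.1 (4) (l. 5235)] -/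
theorem span_blockSet_eq_of_equiv {W W' : Type} [AddCommGroup W] [Module ℂ W] [AddCommGroup W'] [Module ℂ W']
    (ρW : Representation ℂ C.G W) (ρW' : Representation ℂ C.G W') (e : W ≃ₗ[ℂ] W')
    (he : ∀ (g : C.G) (w : W), e (ρW g w) = ρW' g (e w)) :
    Submodule.span (AlgebraicClosure ℚ_[ℓ]) {y | ∃ f ∈ X.omegaHom ι ρW, ∃ w : W, f w = y} =
      Submodule.span (AlgebraicClosure ℚ_[ℓ]) {y | ∃ f' ∈ X.omegaHom ι ρW', ∃ w' : W', f' w' = y} := by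
  rw [X.blockSet_eq_of_equiv ι ρW ρW' e he]

end Sec42Data.EtaleHeckeDatum

end Literature.NumberTheory.Automorphic.Liu2021.AppendixC

namespace Literature.NumberTheory.Automorphic

universe u uk v w

variable {ι : Type u} {k : Type uk} [CommRing k] {V : ι → Type v} [∀ i, AddCommGroup (V i)] [∀ i, Module k (V i)]
  {x₀ : ∀ i, V i} [DecidableEq ι] {W : Type w} [AddCommGroup W] [Module k W] {j : RestrictedFamily V x₀ → W} {S₀ : Finset ι}

/-- **A non-zero restricted tensor product has non-zero factors**: if `(W, j) = ⊗'_i (V i, x₀ i)` and `W` is non-trivial, then every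
`V i` is non-trivial — a zero factor `V i = 0` forces `j x = j (x.update i (0 • 0)) = 0 • j (…) = 0` for every `x`, while the values `j x`
span `W`.  (For [Liu2021, Def. 4.11]'s `ω(μ,ε,χ) = ⊗'_v ω(μ_v,ε_v,χ_v)`: `ω ≠ 0 ⇒ ω_v ≠ 0` at every place, the hypothesis of Lem. D.1 (4).)
[cite: Flath1979, §2] [cite: Liu2021, Def. 4.11 (FJcycle.tex l. 2092–2096); Lem. D.1 (4) (l. 5235)] -/
theorem IsRestrictedTensorProduct.nontrivial_factor (h : IsRestrictedTensorProduct k j S₀) [Nontrivial W] (i : ι) :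
    Nontrivial (V i) := by
  by_contra hV
  have hsub : Subsingleton (V i) := not_nontrivial_iff_subsingleton.1 hV
  have hzero : ∀ x : RestrictedFamily V x₀, j x = 0 := fun x => by
    have hx : x = x.update i ((0 : k) • (0 : V i)) := by
      rw [← x.update_eq_self i, RestrictedFamily.update, RestrictedFamily.update]
      congr 1
      funext j'
      by_cases hj' : j' = i
      · subst hj'; simp [Subsingleton.elim (x j') 0]
      · simp [Function.update_of_ne hj']
    rw [hx, h.isRestrictedMultilinear.map_update_smul, zero_smul]
  have htop := h.span_range_eq_top
  rw [Submodule.span_eq_bot.2 (by rintro _ ⟨x, rfl⟩; exact hzero x)] at htop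
  exact bot_ne_top htop

end Literature.NumberTheory.Automorphic

end
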